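/-
Copyright (c) 2026 the pub-hodgecm-mathlib formalisation cell (harness21).  Prover seat hodgecm-mathlib-K2E3-p17 (g9), routed by K2-lead's valve V2 to R90-S1
(Rogawski §12.2 local packets; section planner R90-C10-plan, deal (E3-1) 15:42:57Z): the split-place induction `n-Ind_{P(2,1)}(σ ⊠ χ′)` is irreducible for
`σ` SUPERCUSPIDAL — the supercuspidal case of socket S1#7 `stub_S1_split_parabolicInd_irreducible_of_unitary`.  2026-09-04.
-/
import Summits.HodgeConjecture.HodgeConjecture.Theorems.K2E3GL3TwoBlockInducedIrreducible   -- ★ (S-C′-irr) `twoBlockInducedIrreducible` (`c = ![0,0,1]`, `[CharZero F]`)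
import Summits.HodgeConjecture.HodgeConjecture.Theorems.K2E3GL3MaximalParabolicRelabel       -- ★ `lt_iff_lastBlockLabel_lt`, `monotone_twoOne`
import Literature.NumberTheory.Automorphic.ParabolicGLReindex                                -- ★ `leviReindexHom`, `leviReindexHom_surjective`, `continuous_∕isOpenMap_leviReindexHom`, `leviProjection_parabolicReindex`
import Literature.NumberTheory.Automorphic.SmoothIndTransport                                -- ★ `SmoothInd.transportEquiv`, `isIrreducible_of_equivariant_equiv`, `rootDeltaChar_transport`
import Literature.NumberTheory.Automorphic.GLnTwoBlockLeviStructure                          -- ★ `mem_standardLeviGL_iff`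
import Literature.NumberTheory.Automorphic.GLnLeviWeightClassFunction                        -- ★ `leviEmbeddingP_leviProjection_levi`
import Literature.NumberTheory.Automorphic.ParabolicSemidirect                               -- ★ `blockDiagonalGL_apply_coe_dite`
import Literature.NumberTheory.Automorphic.ParabolicInductionAdmissibleProofs                -- ★ `isIrreducible_comp_of_surjective`
import Literature.NumberTheory.Automorphic.ParabolicInductionQuotientProofs                  -- ★ `IsSupercuspidal.twist`
import Literature.NumberTheory.Automorphic.IrreducibleClasses                                -- ★ `isIrreducible_twist`, `IsSmooth.twist`
import Literature.NumberTheory.Rogawski1990.SupercuspidalNotSphericalCofinite                -- ★ `IsSupercuspidal.comp_continuousMulEquiv`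
import Literature.NumberTheory.Automorphic.Liu2021.LemD1SplitPlaceOfFacts                    -- ★ `isOpen_ker_of_continuous` (unitary∕continuous characters of `Fˣ` have open kernel)
import HarnessLib

/-!
# R90-S1 (Rogawski §12.2, split places) — `n-Ind_{P_{(2,1)}}^{GL₃(F)}(σ ⊠ χ′)` IS IRREDUCIBLE FOR `σ` SUPERCUSPIDAL

Cell `hodgecm-mathlib`, R90-S1 (section planner R90-C10-plan (g0), deal (E3-1) BY NAME to K2E3-p17 (g9)); THEOREMS ONLY; count-neutral helper
(`--supports stmt-HodgeConjecture-24833 --as helper`); rule R-S1-1: no `Lines` import, the statement is spelled over ★ `parabolicIndGL F (lastBlockLabel 3) …` EXACTLY as the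
tree socket S1#7 `Cruxes/H413/Lines/R90_S1_SplitLocalPacketsB.lean` :130–:143 spells the Levi datum, with the extra binders `[CharZero F]` and `hsc : σ.IsSupercuspidal`.

THE MATHEMATICS ([Zelevinsky1980, Thm. 4.2 p. 184]; [BernsteinZelevinsky1977, Thm. 4.2]; [Rogawski1990, §4.13 p. 64, §13.3 p. 201]).  At a split place `G_v ≅ GL₃(F)` and the transfer of
`ρ_v = σ ⊠ χ′` (`σ` on `GL₂`, `χ′` a character) is `n-Ind_{P(2,1)}(σ ⊠ χ′)`.  For `σ` irreducible smooth SUPERCUSPIDAL the Levi datum `τ = (σ ∘ ev_false) ⊗ (χ′ ∘ det ∘ ev_true)` is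
irreducible (pull-back along a surjection, then twist by a character), smooth (`χ′` continuous ⇒ open kernel, ★ `isOpen_ker_of_continuous`) and supercuspidal (§2: a coefficient of
`σ ∘ ev_false` is a coefficient of `σ` read through the `GL₂`-block, its support lies in `(C × 1)·Z(M)`; then ★ `IsSupercuspidal.twist`), so ★ (S-C′-irr) `twoBlockInducedIrreducible`
[Zelevinsky1980, Thm. 4.2: `ρ × χ` irreducible for `ρ` supercuspidal] applies — after relabelling the parabolic from the socket's `lastBlockLabel 3 : Fin 3 → Bool` to ★'s
`![0,0,1] : Fin 3 → Fin 2` (§1 `exists_leviRelabel`: the ★ `leviReindexHom` along `Equiv.refl` is an isomorphism of topological groups; §3 ★ `SmoothInd.transportEquiv` +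
★ `isIrreducible_of_equivariant_equiv` carry irreducibility of `parabolicIndGL` across the relabelling, as ★ `isFiniteLength_parabolicIndGL_iff_reindex` does for length).
* §1 the Levi relabelling; §2 the Levi datum `τ` (irreducible ∕ smooth ∕ supercuspidal); §3 transport of irreducibility of `parabolicIndGL` along the relabelling;
  §4 HEAD **`splitInducedIrreducible_of_supercuspidal`** = S1#7's body with `[CharZero F]` and `hsc` (binders `_hσa`, `_hσu`, `_hχ'u` kept, unused).
Consumer: R90-C10-p02 (road β: GL₂ dichotomy + assembly of S1#7).

HONEST LABEL: HC_CM is proved only modulo the 7 printed citations (2 remaining named inputs: hLiu418 = stmt-HodgeConjecture-24832, h413 =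
stmt-HodgeConjecture-24833) until rung 0 closes; count-neutral helper, closes no socket by itself (the unitary non-supercuspidal cases of S1#7 are (E3-2) ∕ road β).

## References
* [Zelevinsky1980] A. V. Zelevinsky, *Induced representations of reductive p-adic groups II*, Ann. Sci. ÉNS 13 (1980), Thm. 4.2 p. 184.
* [BernsteinZelevinsky1977] I. N. Bernstein, A. V. Zelevinsky, *Induced representations of reductive p-adic groups I*, Ann. Sci. ÉNS 10 (1977), §2.3, Thm. 4.2.
* [Rogawski1990] J. D. Rogawski, *Automorphic Representations of Unitary Groups in Three Variables*, Annals of Math. Studies 123 (1990), §4.13 p. 64, §13.3 p. 201.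
* [HarishChandra1970] Harish-Chandra, *Harmonic analysis on reductive p-adic groups*, LNM 162 (1970), Part I §3 p. 9.
-/

set_option autoImplicit false
-- the mandated namespace repeats `HodgeConjecture.HodgeConjecture`, as in every `Theorems/*.lean` of this sub-problem
set_option linter.dupNamespace false

noncomputable section

open Representation Function Literature.NumberTheory.Automorphic Literature.NumberTheory.Automorphic.Zelevinsky1980
open Literature.NumberTheory.GaloisRepresentations.IsNonarchimedeanLocalField
open scoped MatrixGroups

namespace Summit.HodgeConjecture.HodgeConjecture.Cruxes.H413.R90S1SplitInducedIrreducibleOfSupercuspidal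

variable (F : Type) [Field F] [ValuativeRel F] [TopologicalSpace F] [IsNonarchimedeanLocalField F]

/-! ## §1 Labels and the Levi relabelling `Π_b GL {i // ![0,0,1] i = b} ≃ₜ* Π_a GL {i // lastBlockLabel 3 i = a}` -/

/-- The two labellings of `P_{(2,1)}` compare index pairs identically (strict form, along `Equiv.refl`). [cite: BernsteinZelevinsky1977, §2.1] -/
theorem hcc_lastBlockLabel : ∀ i j : Fin 3, (![0, 0, 1] : Fin 3 → Fin 2) i < (![0, 0, 1] : Fin 3 → Fin 2) j ↔ lastBlockLabel 3 ((Equiv.refl (Fin 3)) i) < lastBlockLabel 3 ((Equiv.refl (Fin 3)) j) :=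
  fun i j => K2E3GL3MaximalParabolicRelabel.lt_iff_lastBlockLabel_lt j i

omit [ValuativeRel F] [TopologicalSpace F] [IsNonarchimedeanLocalField F] in
/-- `reindexGL` along `Equiv.refl` is the identity. [folklore] -/
theorem reindexGL_refl_apply (g : GL (Fin 3) F) : reindexGL (k := F) (Equiv.refl (Fin 3)) g = g :=
  Units.ext (by rw [coe_reindexGL]; exact Matrix.submatrix_id_id _)

omit [ValuativeRel F] [TopologicalSpace F] [IsNonarchimedeanLocalField F] in
/-- **The relabelling homomorphism ★ `leviReindexHom` (along `Equiv.refl`) is INJECTIVE**: the relabelled Levi element has the same block-diagonal matrix in `GL₃(F)`.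
[cite: BernsteinZelevinsky1977, §2.1] -/
theorem leviReindexHom_injective : Function.Injective (leviReindexHom F (lastBlockLabel 3) (Equiv.refl (Fin 3)) (![0, 0, 1] : Fin 3 → Fin 2) hcc_lastBlockLabel) := by
  intro m₁ m₂ h
  -- the relabelled block-diagonal matrices lie in the Levi of `lastBlockLabel 3`
  have hmem : ∀ m : (Π b, GL {i // (![0, 0, 1] : Fin 3 → Fin 2) i = b} F), (parabolicReindex F (lastBlockLabel 3) (Equiv.refl (Fin 3)) (![0, 0, 1] : Fin 3 → Fin 2) hcc_lastBlockLabel (leviEmbeddingP F (![0, 0, 1] : Fin 3 → Fin 2) m) : GL (Fin 3) F) ∈ standardLeviGL F (lastBlockLabel 3) := by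
    intro m
    rw [coe_parabolicReindex, reindexGL_refl_apply, coe_leviEmbeddingP, mem_standardLeviGL_iff]
    intro i j hij
    rw [blockDiagonalGL_apply_coe_dite, dif_neg]
    intro hij'
    exact hij (by simpa using (label_eq_iff hcc_lastBlockLabel i j).1 hij')
  have hkey : ∀ m : (Π b, GL {i // (![0, 0, 1] : Fin 3 → Fin 2) i = b} F), (leviEmbeddingP F (lastBlockLabel 3) ((leviReindexHom F (lastBlockLabel 3) (Equiv.refl (Fin 3)) (![0, 0, 1] : Fin 3 → Fin 2) hcc_lastBlockLabel) m) : GL (Fin 3) F) = blockDiagonalGL F (![0, 0, 1] : Fin 3 → Fin 2) m := by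
    intro m
    have h1 : (leviReindexHom F (lastBlockLabel 3) (Equiv.refl (Fin 3)) (![0, 0, 1] : Fin 3 → Fin 2) hcc_lastBlockLabel) m =
        leviProjection F (lastBlockLabel 3) ⟨((⟨_, hmem m⟩ : ↥(standardLeviGL F (lastBlockLabel 3))) : GL (Fin 3) F), standardLeviGL_le F _ (hmem m)⟩ := rfl
    rw [h1, leviEmbeddingP_leviProjection_levi]
    change ((parabolicReindex F (lastBlockLabel 3) (Equiv.refl (Fin 3)) (![0, 0, 1] : Fin 3 → Fin 2) hcc_lastBlockLabel (leviEmbeddingP F (![0, 0, 1] : Fin 3 → Fin 2) m) : ↥(standardParabolicGL F (lastBlockLabel 3))) : GL (Fin 3) F) = _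
    rw [coe_parabolicReindex, reindexGL_refl_apply, coe_leviEmbeddingP]
  have h' : blockDiagonalGL F (![0, 0, 1] : Fin 3 → Fin 2) m₁ = blockDiagonalGL F (![0, 0, 1] : Fin 3 → Fin 2) m₂ := by rw [← hkey, ← hkey, h]
  have h'' : leviEmbeddingP F (![0, 0, 1] : Fin 3 → Fin 2) m₁ = leviEmbeddingP F (![0, 0, 1] : Fin 3 → Fin 2) m₂ := Subtype.ext (by rw [coe_leviEmbeddingP, coe_leviEmbeddingP, h'])
  have := congrArg (leviProjection F (![0, 0, 1] : Fin 3 → Fin 2)) h''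
  rwa [leviProjection_leviEmbeddingP_apply, leviProjection_leviEmbeddingP_apply] at this

/-- **THE LEVI RELABELLING AS AN ISOMORPHISM OF TOPOLOGICAL GROUPS**: ★ `leviReindexHom` along `Equiv.refl` is bijective, continuous and open (★), hence a `≃ₜ*`; recorded existentially
with its defining equation. [cite: BernsteinZelevinsky1977, §2.1] -/
theorem exists_leviRelabel :
    ∃ E : (Π b, GL {i // (![0, 0, 1] : Fin 3 → Fin 2) i = b} F) ≃ₜ* (Π a : Bool, GL {i : Fin 3 // lastBlockLabel 3 i = a} F), ∀ m, E m = (leviReindexHom F (lastBlockLabel 3) (Equiv.refl (Fin 3)) (![0, 0, 1] : Fin 3 → Fin 2) hcc_lastBlockLabel) m := by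
  haveI : IsTopologicalRing F := inferInstance
  have hbij : Function.Bijective (leviReindexHom F (lastBlockLabel 3) (Equiv.refl (Fin 3)) (![0, 0, 1] : Fin 3 → Fin 2) hcc_lastBlockLabel) :=
    ⟨leviReindexHom_injective F, leviReindexHom_surjective F (lastBlockLabel 3) (Equiv.refl (Fin 3)) (![0, 0, 1] : Fin 3 → Fin 2) hcc_lastBlockLabel⟩
  let e₀ : (Π b, GL {i // (![0, 0, 1] : Fin 3 → Fin 2) i = b} F) ≃ (Π a : Bool, GL {i : Fin 3 // lastBlockLabel 3 i = a} F) := Equiv.ofBijective _ hbij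
  let h₀ : (Π b, GL {i // (![0, 0, 1] : Fin 3 → Fin 2) i = b} F) ≃ₜ (Π a : Bool, GL {i : Fin 3 // lastBlockLabel 3 i = a} F) := e₀.toHomeomorphOfContinuousOpen
    (continuous_leviReindexHom F (lastBlockLabel 3) (Equiv.refl (Fin 3)) (![0, 0, 1] : Fin 3 → Fin 2) hcc_lastBlockLabel)
    (isOpenMap_leviReindexHom F (lastBlockLabel 3) (Equiv.refl (Fin 3)) (![0, 0, 1] : Fin 3 → Fin 2) hcc_lastBlockLabel)
  refine ⟨{ MulEquiv.ofBijective (leviReindexHom F (lastBlockLabel 3) (Equiv.refl (Fin 3)) (![0, 0, 1] : Fin 3 → Fin 2) hcc_lastBlockLabel) hbij with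
            continuous_toFun := h₀.continuous
            continuous_invFun := h₀.symm.continuous }, fun m => rfl⟩

/-! ## §2 The Levi datum `τ = (σ ∘ ev_false) ⊗ (χ′ ∘ det ∘ ev_true)` -/

variable {F}
variable {W : Type} [AddCommGroup W] [Module ℂ W] (σ : Representation ℂ (GL {i : Fin 3 // lastBlockLabel 3 i = false} F) W)

omit [ValuativeRel F] [TopologicalSpace F] [IsNonarchimedeanLocalField F] in
/-- The `GL₁`-block `{2}` of the labelling `lastBlockLabel 3` is commutative (`1 × 1` matrices). [folklore] -/
theorem mul_comm_blockTrue (a b : GL {i : Fin 3 // lastBlockLabel 3 i = true} F) : a * b = b * a := by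
  have hsub : ∀ i : {i : Fin 3 // lastBlockLabel 3 i = true}, i = ⟨2, rfl⟩ := fun i =>
    Subtype.ext (by have hi := i.2; revert hi; generalize (i : Fin 3) = k; intro hk; fin_cases k <;> simp_all [lastBlockLabel])
  haveI : Subsingleton {i : Fin 3 // lastBlockLabel 3 i = true} := ⟨fun x y => (hsub x).trans (hsub y).symm⟩
  apply Units.ext
  ext i j
  rw [Units.val_mul, Units.val_mul, Matrix.mul_apply, Matrix.mul_apply]
  refine Finset.sum_congr rfl fun k _ => ?_
  obtain rfl := Subsingleton.elim i k
  obtain rfl := Subsingleton.elim j i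
  ring

/-- **THE LEVI DATUM OF A SUPERCUSPIDAL `σ` IS SUPERCUSPIDAL**: a coefficient of `τ = (σ ∘ ev_false) ⊗ (χ′∘det∘ev_true)` is a unit multiple of a coefficient of `σ` read through
the `GL₂`-block, so its support lies in `(C × 1) · Z(M)`, `Z(M) ⊇ Z(GL₂-block) × GL₁-block`; no hypothesis on `χ′` is needed.
[cite: HarishChandra1970, Part I §3 p. 9] [cite: BernsteinZelevinsky1977, §2.3] -/
theorem isSupercuspidal_leviDatum (hσ : σ.IsSupercuspidal) (χ' : Fˣ →* ℂˣ) : (Representation.twist (σ.comp (Pi.evalMonoidHom (fun a : Bool => GL {i : Fin 3 // lastBlockLabel 3 i = a} F) false)) (χ'.comp (Matrix.GeneralLinearGroup.det.comp (Pi.evalMonoidHom (fun a : Bool => GL {i : Fin 3 // lastBlockLabel 3 i = a} F) true)))).IsSupercuspidal := by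
  haveI : IsTopologicalRing F := inferInstance
  intro φ hφ v
  have hcont : Continuous (fun x : GL {i : Fin 3 // lastBlockLabel 3 i = false} F => Pi.mulSingle (M := fun a : Bool => GL {i : Fin 3 // lastBlockLabel 3 i = a} F) false x) :=
    continuous_pi fun a => by
      cases a
      · simp only [Pi.mulSingle_eq_same]; exact continuous_id
      · simp only [Pi.mulSingle_eq_of_ne (show true ≠ false by decide)]; exact continuous_const
  -- the character is trivial on the `GL₂`-block
  have hχ1 : ∀ x : GL {i : Fin 3 // lastBlockLabel 3 i = false} F, (χ'.comp (Matrix.GeneralLinearGroup.det.comp (Pi.evalMonoidHom (fun a : Bool => GL {i : Fin 3 // lastBlockLabel 3 i = a} F) true))) (Pi.mulSingle (M := fun a : Bool => GL {i : Fin 3 // lastBlockLabel 3 i = a} F) false x) = 1 := fun x => by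
    rw [MonoidHom.comp_apply, MonoidHom.comp_apply, Pi.evalMonoidHom_apply, Pi.mulSingle_eq_of_ne (show true ≠ false by decide), map_one, map_one]
  -- `φ` is a smooth linear form of `σ`: its stabiliser contains the preimage of the (open) stabiliser under the block embedding
  have hφσ : φ ∈ σ.contragredient := by
    rw [Representation.mem_contragredient] at hφ ⊢
    refine σ.dual.isSmoothVector_of_le (K := ((Representation.dual (Representation.twist (σ.comp (Pi.evalMonoidHom (fun a : Bool => GL {i : Fin 3 // lastBlockLabel 3 i = a} F) false)) (χ'.comp (Matrix.GeneralLinearGroup.det.comp (Pi.evalMonoidHom (fun a : Bool => GL {i : Fin 3 // lastBlockLabel 3 i = a} F) true))))).stabilizerSubgroup φ).comap (MonoidHom.mulSingle (fun a : Bool => GL {i : Fin 3 // lastBlockLabel 3 i = a} F) false))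
      (hφ.preimage hcont) fun g hg => ?_
    rw [Subgroup.mem_comap, mem_stabilizerSubgroup] at hg
    rw [mem_stabilizerSubgroup]
    refine LinearMap.ext fun w => ?_
    have hgw := LinearMap.congr_fun hg w
    rw [Representation.dual_apply, Module.Dual.transpose_apply, LinearMap.comp_apply, ← map_inv, MonoidHom.mulSingle_apply, Representation.twist_apply, hχ1,
      Units.val_one, one_smul, MonoidHom.comp_apply, Pi.evalMonoidHom_apply, Pi.mulSingle_eq_same] at hgw
    rw [Representation.dual_apply, Module.Dual.transpose_apply, LinearMap.comp_apply]
    exact hgw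
  obtain ⟨C, hC, hsupp⟩ := hσ φ hφσ v
  refine ⟨(fun x : GL {i : Fin 3 // lastBlockLabel 3 i = false} F => Pi.mulSingle (M := fun a : Bool => GL {i : Fin 3 // lastBlockLabel 3 i = a} F) false x) '' C, hC.image hcont, fun m hm => ?_⟩
  have hm' : m false ∈ Function.support (σ.matrixCoeff φ v) := by
    rw [Function.mem_support] at hm ⊢
    rw [matrixCoeff_apply, Representation.twist_apply, map_smul, smul_eq_mul] at hm
    rw [matrixCoeff_apply]
    exact right_ne_zero_of_mul hm
  obtain ⟨x, hx, z, hz, hxz⟩ := Set.mem_mul.1 (hsupp hm')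
  refine Set.mem_mul.2 ⟨Pi.mulSingle (M := fun a : Bool => GL {i : Fin 3 // lastBlockLabel 3 i = a} F) false x, ⟨x, hx, rfl⟩, (Pi.mulSingle (M := fun a : Bool => GL {i : Fin 3 // lastBlockLabel 3 i = a} F) false x)⁻¹ * m, ?_, by rw [mul_inv_cancel_left]⟩
  rw [SetLike.mem_coe, Subgroup.mem_center_iff]
  intro g
  funext a
  cases a with
  | false =>
    rw [Pi.mul_apply, Pi.mul_apply, Pi.mul_apply, Pi.mul_apply, Pi.inv_apply, Pi.mulSingle_eq_same, ← hxz, inv_mul_cancel_left]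
    exact (Subgroup.mem_center_iff.1 hz (g false))
  | true =>
    rw [Pi.mul_apply, Pi.mul_apply, Pi.mul_apply, Pi.mul_apply, Pi.inv_apply, Pi.mulSingle_eq_of_ne (show true ≠ false by decide), inv_one, one_mul]
    exact mul_comm_blockTrue _ _

/-- The character `χ′ ∘ det ∘ ev_true` of the Levi has open kernel when `χ′` is continuous. [cite: BushnellHenniart2006, §1.1] -/
theorem isOpen_ker_chi (χ' : Fˣ →* ℂˣ) (hχ'c : Continuous fun x => ((χ' x : ℂˣ) : ℂ)) :
    IsOpen (((χ'.comp (Matrix.GeneralLinearGroup.det.comp (Pi.evalMonoidHom (fun a : Bool => GL {i : Fin 3 // lastBlockLabel 3 i = a} F) true)))).ker : Set (Π a : Bool, GL {i : Fin 3 // lastBlockLabel 3 i = a} F)) := by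
  haveI : IsTopologicalRing F := inferInstance
  have hker : (((χ'.comp (Matrix.GeneralLinearGroup.det.comp (Pi.evalMonoidHom (fun a : Bool => GL {i : Fin 3 // lastBlockLabel 3 i = a} F) true)))).ker : Set (Π a : Bool, GL {i : Fin 3 // lastBlockLabel 3 i = a} F)) =
      (fun m : (Π a : Bool, GL {i : Fin 3 // lastBlockLabel 3 i = a} F) => Matrix.GeneralLinearGroup.det (m true)) ⁻¹' ((χ'.ker : Subgroup Fˣ) : Set Fˣ) := by
    ext m
    simp only [SetLike.mem_coe, MonoidHom.mem_ker, Set.mem_preimage, MonoidHom.comp_apply, Pi.evalMonoidHom_apply]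
  rw [hker]
  exact (Liu2021.SplitPlace.isOpen_ker_of_continuous χ' hχ'c).preimage
    (Matrix.GeneralLinearGroup.continuous_det.comp (continuous_apply true))

set_option maxHeartbeats 800000 in  -- cumulative budget over the large Levi-datum terms
/-- **THE LEVI DATUM IS IRREDUCIBLE, SMOOTH AND SUPERCUSPIDAL** when `σ` is irreducible smooth supercuspidal and `χ′` is continuous.
[cite: BernsteinZelevinsky1977, §2.3] [cite: HarishChandra1970, Part I §3 p. 9] -/
theorem leviDatum_irreducible_smooth_supercuspidal [σ.IsIrreducible] (hσs : σ.IsSmooth) (hsc : σ.IsSupercuspidal)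
    (χ' : Fˣ →* ℂˣ) (hχ'c : Continuous fun x => ((χ' x : ℂˣ) : ℂ)) :
    (Representation.twist (σ.comp (Pi.evalMonoidHom (fun a : Bool => GL {i : Fin 3 // lastBlockLabel 3 i = a} F) false)) (χ'.comp (Matrix.GeneralLinearGroup.det.comp (Pi.evalMonoidHom (fun a : Bool => GL {i : Fin 3 // lastBlockLabel 3 i = a} F) true)))).IsIrreducible ∧ (Representation.twist (σ.comp (Pi.evalMonoidHom (fun a : Bool => GL {i : Fin 3 // lastBlockLabel 3 i = a} F) false)) (χ'.comp (Matrix.GeneralLinearGroup.det.comp (Pi.evalMonoidHom (fun a : Bool => GL {i : Fin 3 // lastBlockLabel 3 i = a} F) true)))).IsSmooth ∧ (Representation.twist (σ.comp (Pi.evalMonoidHom (fun a : Bool => GL {i : Fin 3 // lastBlockLabel 3 i = a} F) false)) (χ'.comp (Matrix.GeneralLinearGroup.det.comp (Pi.evalMonoidHom (fun a : Bool => GL {i : Fin 3 // lastBlockLabel 3 i = a} F) true)))).IsSupercuspidal := by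
  haveI : IsTopologicalRing F := inferInstance
  have hsurj : Function.Surjective (Pi.evalMonoidHom (fun a : Bool => GL {i : Fin 3 // lastBlockLabel 3 i = a} F) false) := fun g => ⟨Pi.mulSingle false g, by rw [Pi.evalMonoidHom_apply, Pi.mulSingle_eq_same]⟩
  have hopen := isOpen_ker_chi χ' hχ'c
  have h1 : (Representation.twist (σ.comp (Pi.evalMonoidHom (fun a : Bool => GL {i : Fin 3 // lastBlockLabel 3 i = a} F) false)) (χ'.comp (Matrix.GeneralLinearGroup.det.comp (Pi.evalMonoidHom (fun a : Bool => GL {i : Fin 3 // lastBlockLabel 3 i = a} F) true)))).IsIrreducible := by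
    haveI := isIrreducible_comp_of_surjective σ (Pi.evalMonoidHom (fun a : Bool => GL {i : Fin 3 // lastBlockLabel 3 i = a} F) false) hsurj
    exact Representation.isIrreducible_twist _ _
  have hcev : Continuous (fun m : (Π a : Bool, GL {i : Fin 3 // lastBlockLabel 3 i = a} F) => (Pi.evalMonoidHom (fun a : Bool => GL {i : Fin 3 // lastBlockLabel 3 i = a} F) false) m) := continuous_apply false
  have h2 : (Representation.twist (σ.comp (Pi.evalMonoidHom (fun a : Bool => GL {i : Fin 3 // lastBlockLabel 3 i = a} F) false)) (χ'.comp (Matrix.GeneralLinearGroup.det.comp (Pi.evalMonoidHom (fun a : Bool => GL {i : Fin 3 // lastBlockLabel 3 i = a} F) true)))).IsSmooth := (IsSmooth.comp_of_continuous σ (Pi.evalMonoidHom (fun a : Bool => GL {i : Fin 3 // lastBlockLabel 3 i = a} F) false) hcev hσs).twist hopen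
  have h3 : (Representation.twist (σ.comp (Pi.evalMonoidHom (fun a : Bool => GL {i : Fin 3 // lastBlockLabel 3 i = a} F) false)) (χ'.comp (Matrix.GeneralLinearGroup.det.comp (Pi.evalMonoidHom (fun a : Bool => GL {i : Fin 3 // lastBlockLabel 3 i = a} F) true)))).IsSupercuspidal := isSupercuspidal_leviDatum σ hsc χ'
  exact ⟨h1, h2, h3⟩

/-! ## §3 Transport of irreducibility of `parabolicIndGL` along the relabelling -/

set_option maxHeartbeats 1600000 in  -- cumulative budget over the large induced-module terms
/-- **IRREDUCIBILITY OF `i_P σ` IS INVARIANT UNDER THE RELABELLING `![0,0,1] ↔ lastBlockLabel 3`** (the proof of ★ `isFiniteLength_parabolicIndGL_iff_reindex` with ★ `isIrreducible_of_equivariant_equiv`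
in place of the length comparison: `f ↦ f ∘ (reindexGL refl)⁻¹` is an equivariant linear isomorphism of the two induced modules). [cite: BernsteinZelevinsky1977, §2.3] -/
theorem isIrreducible_parabolicIndGL_lastBlockLabel_of_fin [LocallyCompactSpace ↥(standardParabolicGL F (lastBlockLabel 3))]
    {W : Type} [AddCommGroup W] [Module ℂ W] (ω : Representation ℂ (Π a : Bool, GL {i : Fin 3 // lastBlockLabel 3 i = a} F) W)
    (h : (parabolicIndGL F (![0, 0, 1] : Fin 3 → Fin 2) (ω.comp (leviReindexHom F (lastBlockLabel 3) (Equiv.refl (Fin 3)) (![0, 0, 1] : Fin 3 → Fin 2) hcc_lastBlockLabel))).IsIrreducible) :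
    (parabolicIndGL F (lastBlockLabel 3) ω).IsIrreducible := by
  haveI : IsTopologicalRing F := inferInstance
  have hφ : Continuous (reindexGL (k := F) (Equiv.refl (Fin 3))) :=
    Units.continuous_map (f := (Matrix.reindexAlgEquiv F F (Equiv.refl (Fin 3))).toMulEquiv.toMonoidHom) (continuous_id.matrix_reindex _ _)
  have hφ' : Continuous (reindexGL (k := F) (Equiv.refl (Fin 3))).symm :=
    Units.continuous_map (f := (Matrix.reindexAlgEquiv F F (Equiv.refl (Fin 3)).symm).toMulEquiv.toMonoidHom) (continuous_id.matrix_reindex _ _)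
  have hH : ∀ x, (reindexGL (k := F) (Equiv.refl (Fin 3))) x ∈ standardParabolicGL F (lastBlockLabel 3) ↔ x ∈ standardParabolicGL F (![0, 0, 1] : Fin 3 → Fin 2) :=
    reindexGL_mem_standardParabolicGL_iff F hcc_lastBlockLabel
  have hσ : ∀ x : ↥(standardParabolicGL F (![0, 0, 1] : Fin 3 → Fin 2)),
      Representation.twist (((ω.comp (leviReindexHom F (lastBlockLabel 3) (Equiv.refl (Fin 3)) (![0, 0, 1] : Fin 3 → Fin 2) hcc_lastBlockLabel)).comp (leviProjection F (![0, 0, 1] : Fin 3 → Fin 2)))) (rootDeltaChar (standardParabolicGL F (![0, 0, 1] : Fin 3 → Fin 2))) x =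
        Representation.twist (ω.comp (leviProjection F (lastBlockLabel 3))) (rootDeltaChar (standardParabolicGL F (lastBlockLabel 3))) ⟨(reindexGL (k := F) (Equiv.refl (Fin 3))) x, (hH x).2 x.2⟩ := by
    intro x
    refine LinearMap.ext fun v => ?_
    change ((rootDeltaChar (standardParabolicGL F (![0, 0, 1] : Fin 3 → Fin 2)) x : ℂˣ) : ℂ) • ω ((leviReindexHom F (lastBlockLabel 3) (Equiv.refl (Fin 3)) (![0, 0, 1] : Fin 3 → Fin 2) hcc_lastBlockLabel) (leviProjection F (![0, 0, 1] : Fin 3 → Fin 2) x)) v =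
      ((rootDeltaChar (standardParabolicGL F (lastBlockLabel 3)) ⟨(reindexGL (k := F) (Equiv.refl (Fin 3))) x, (hH x).2 x.2⟩ : ℂˣ) : ℂ) • ω (leviProjection F (lastBlockLabel 3) ⟨(reindexGL (k := F) (Equiv.refl (Fin 3))) x, (hH x).2 x.2⟩) v
    rw [rootDeltaChar_transport (reindexGL (k := F) (Equiv.refl (Fin 3))) hφ hφ' hH x, ← leviProjection_parabolicReindex F (lastBlockLabel 3) (Equiv.refl (Fin 3)) (![0, 0, 1] : Fin 3 → Fin 2) hcc_lastBlockLabel x]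
    rfl
  haveI : (smoothIndRep (standardParabolicGL F (![0, 0, 1] : Fin 3 → Fin 2)) (Representation.twist (((ω.comp (leviReindexHom F (lastBlockLabel 3) (Equiv.refl (Fin 3)) (![0, 0, 1] : Fin 3 → Fin 2) hcc_lastBlockLabel)).comp (leviProjection F (![0, 0, 1] : Fin 3 → Fin 2)))) (rootDeltaChar (standardParabolicGL F (![0, 0, 1] : Fin 3 → Fin 2))))).IsIrreducible := h
  exact isIrreducible_of_equivariant_equiv (reindexGL (k := F) (Equiv.refl (Fin 3)))
    (SmoothInd.transportEquiv (reindexGL (k := F) (Equiv.refl (Fin 3))) hφ hφ' hH hσ) (SmoothInd.transportEquiv_smoothIndRep (reindexGL (k := F) (Equiv.refl (Fin 3))) hφ hφ' hH hσ)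

/-! ## §4 The head: S1#7 for supercuspidal `σ` -/

set_option maxHeartbeats 1600000 in  -- cumulative budget over the large induced-module terms
/-- **`n-Ind_{P(2,1)}^{GL₃(F)}(σ ⊠ χ′)` IS IRREDUCIBLE FOR `σ` SUPERCUSPIDAL** (irreducible smooth, `χ′` continuous) — socket S1#7's body with the extra binders `[CharZero F]`, `hsc`; the binders
`_hσa`, `_hσu`, `_hχ'u` of the socket are kept and unused (the supercuspidal case needs neither admissibility nor unitarity). [cite: Zelevinsky1980, Thm. 4.2 p. 184]
[cite: BernsteinZelevinsky1977, Thm. 4.2] [cite: Rogawski1990, §4.13 p. 64, §13.3 p. 201] -/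
theorem splitInducedIrreducible_of_supercuspidal :
    ∀ (F : Type) [Field F] [ValuativeRel F] [TopologicalSpace F] [IsNonarchimedeanLocalField F] [CharZero F]
      [LocallyCompactSpace ↥(standardParabolicGL F (Zelevinsky1980.lastBlockLabel 3))]
      (W : Type) [AddCommGroup W] [Module ℂ W]
      (σ : Representation ℂ (GL {i : Fin 3 // Zelevinsky1980.lastBlockLabel 3 i = false} F) W)
      (_hσi : σ.IsIrreducible) (_hσs : σ.IsSmooth) (_hσa : σ.IsAdmissible) (_hσu : σ.IsUnitarizable) (hsc : σ.IsSupercuspidal)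
      (χ' : Fˣ →* ℂˣ) (_hχ'u : ∀ x, ‖((χ' x : ℂˣ) : ℂ)‖ = 1) (_hχ'c : Continuous fun x => ((χ' x : ℂˣ) : ℂ)),
      (Representation.parabolicIndGL F (Zelevinsky1980.lastBlockLabel 3)
        (Representation.twist
          (σ.comp (Pi.evalMonoidHom (fun a : Bool => GL {i : Fin 3 // Zelevinsky1980.lastBlockLabel 3 i = a} F) false))
          (χ'.comp (Matrix.GeneralLinearGroup.det.comp
            (Pi.evalMonoidHom (fun a : Bool => GL {i : Fin 3 // Zelevinsky1980.lastBlockLabel 3 i = a} F) true))))).IsIrreducible := by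
  intro F _ _ _ _ _ _ W _ _ σ hσi hσs _ _ hsc χ' _ hχ'c
  haveI : IsTopologicalRing F := inferInstance
  haveI := hσi
  obtain ⟨h1, h2, h3⟩ := leviDatum_irreducible_smooth_supercuspidal σ hσs hsc χ' hχ'c
  obtain ⟨E, hE⟩ := exists_leviRelabel F
  haveI := h1
  have hF1 : Representation.IsIrreducible ((Representation.twist (σ.comp (Pi.evalMonoidHom (fun a : Bool => GL {i : Fin 3 // lastBlockLabel 3 i = a} F) false)) (χ'.comp (Matrix.GeneralLinearGroup.det.comp (Pi.evalMonoidHom (fun a : Bool => GL {i : Fin 3 // lastBlockLabel 3 i = a} F) true)))).comp (E : (Π b, GL {i // (![0, 0, 1] : Fin 3 → Fin 2) i = b} F) →* (Π a : Bool, GL {i : Fin 3 // lastBlockLabel 3 i = a} F))) := isIrreducible_comp_of_surjective _ (E : (Π b, GL {i // (![0, 0, 1] : Fin 3 → Fin 2) i = b} F) →* (Π a : Bool, GL {i : Fin 3 // lastBlockLabel 3 i = a} F)) E.surjective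
  have hF2 : Representation.IsSmooth ((Representation.twist (σ.comp (Pi.evalMonoidHom (fun a : Bool => GL {i : Fin 3 // lastBlockLabel 3 i = a} F) false)) (χ'.comp (Matrix.GeneralLinearGroup.det.comp (Pi.evalMonoidHom (fun a : Bool => GL {i : Fin 3 // lastBlockLabel 3 i = a} F) true)))).comp (E : (Π b, GL {i // (![0, 0, 1] : Fin 3 → Fin 2) i = b} F) →* (Π a : Bool, GL {i : Fin 3 // lastBlockLabel 3 i = a} F))) := IsSmooth.comp_of_continuous _ (E : (Π b, GL {i // (![0, 0, 1] : Fin 3 → Fin 2) i = b} F) →* (Π a : Bool, GL {i : Fin 3 // lastBlockLabel 3 i = a} F)) E.continuous h2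
  have hF3 : Representation.IsSupercuspidal ((Representation.twist (σ.comp (Pi.evalMonoidHom (fun a : Bool => GL {i : Fin 3 // lastBlockLabel 3 i = a} F) false)) (χ'.comp (Matrix.GeneralLinearGroup.det.comp (Pi.evalMonoidHom (fun a : Bool => GL {i : Fin 3 // lastBlockLabel 3 i = a} F) true)))).comp (E : (Π b, GL {i // (![0, 0, 1] : Fin 3 → Fin 2) i = b} F) →* (Π a : Bool, GL {i : Fin 3 // lastBlockLabel 3 i = a} F))) := h3.comp_continuousMulEquiv E
  have hE' : (E : (Π b, GL {i // (![0, 0, 1] : Fin 3 → Fin 2) i = b} F) →* (Π a : Bool, GL {i : Fin 3 // lastBlockLabel 3 i = a} F)) = (leviReindexHom F (lastBlockLabel 3) (Equiv.refl (Fin 3)) (![0, 0, 1] : Fin 3 → Fin 2) hcc_lastBlockLabel) := MonoidHom.ext fun m => hE m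
  rw [hE'] at hF1 hF2 hF3
  have hsurj2 : Function.Surjective (![0, 0, 1] : Fin 3 → Fin 2) := fun a => by
    fin_cases a
    · exact ⟨0, rfl⟩
    · exact ⟨2, rfl⟩
  have hind := K2E3GL3TwoBlockInducedIrreducible.twoBlockInducedIrreducible F (![0, 0, 1] : Fin 3 → Fin 2) K2E3GL3MaximalParabolicRelabel.monotone_twoOne hsurj2 W
    ((Representation.twist (σ.comp (Pi.evalMonoidHom (fun a : Bool => GL {i : Fin 3 // lastBlockLabel 3 i = a} F) false)) (χ'.comp (Matrix.GeneralLinearGroup.det.comp (Pi.evalMonoidHom (fun a : Bool => GL {i : Fin 3 // lastBlockLabel 3 i = a} F) true)))).comp (leviReindexHom F (lastBlockLabel 3) (Equiv.refl (Fin 3)) (![0, 0, 1] : Fin 3 → Fin 2) hcc_lastBlockLabel)) hF1 hF2 hF3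
  exact isIrreducible_parabolicIndGL_lastBlockLabel_of_fin (Representation.twist (σ.comp (Pi.evalMonoidHom (fun a : Bool => GL {i : Fin 3 // lastBlockLabel 3 i = a} F) false)) (χ'.comp (Matrix.GeneralLinearGroup.det.comp (Pi.evalMonoidHom (fun a : Bool => GL {i : Fin 3 // lastBlockLabel 3 i = a} F) true)))) hind

end Summit.HodgeConjecture.HodgeConjecture.Cruxes.H413.R90S1SplitInducedIrreducibleOfSupercuspidal

end
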